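/-
Copyright: the b2b-balaban T⁴-continuum CRUX team, row NE7b leaf lineage `t4-ne7b-formalise-leaf-05` (gen 153). Project licence.
-/
import Mathlib.LinearAlgebra.Matrix.DotProduct
import Mathlib.Data.Real.Basic

/-!
# THE GAUGE LETTERS (iso) AND (cov) OF THE (h2) SKELETON FROM SUMMAND-WISE COVARIANCE: a gauge acting on each bond's colour fibre by an orthogonal matrix is an
# isometry of `⬝ᵥ` (`‖uX‖² = ‖X‖²`), and a sum-of-squares form whose square-root functionals transform by orthogonal rotations (`f_p(uX) = R_p·g_p(X)`,
# [B9] (3.29)–(3.32): `(∂_{V^u}B^u)(P) = Ad(u(y_P))(∂_V B)(P)`, `(Q₁(V^u)B^u)(c) = Ad(u(c₋))(Q₁(V)B)(c)`) is gauge INVARIANT: `⟨X, K_F X⟩ = F′(uX)` — SectE-interface-proof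
# Lemma 5.5's first sentence «summand-wise gauge covariance … `|·|` is `Ad`-invariant, so `F_V^{full}(B′) = F_{V^u}^{full}(B′^u)`» (row NE7b, node U5c; residual (R2′)
# family (2), letter (ℓ1); kernel lemmas)

Cell `pub-balaban`, sub-cell `t4`, spine estimate NE7b (`T4WeightBudget.RelWeightBound`; the cell's OWN estimate — NOT PRINTED in [Bałaban 1983–89],
NOT PROVED).  Crux-route work under `Spine/NE7b/`; NOTHING of Bałaban's is asserted; no `def`; zero `sorry`; no `T4Continuum/Support` leaf (FREEZE (0)).
Imports: Mathlib only (`LinearAlgebra.Matrix.DotProduct`, `Data.Real.Basic`).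

WHY.  `…AdmissibleFloorIMS.admissible_floor` (this lineage, p378268 ✓) asks, per cube `s`, the letters (iso) `u_s(h_s·x) ⬝ᵥ u_s(h_s·x) = (h_s·x) ⬝ᵥ (h_s·x)` and
(cov) `⟨h_s·x, K_F(h_s·x)⟩ = F′_s(u_s(h_s·x))`.  In print both come from ONE structural fact: the local gauge `u_s` acts on the `𝔤 ≅ ℝ^κ`-valued bond field
bond by bond through `Ad(u(b₋)) ∈ SO(κ)`, and every square-root functional of the full form (plaquette curls, block averages) of the gauged field is a rotation
`Ad(·)` of the corresponding functional at the original background.  THIS FILE is that fact in the skeleton's currency (`m = B × κ`, real matrices): after it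
the (h2) skeleton's (iso)∕(cov) display BY VALUE only «`Ad` is orthogonal on `𝔤`» and the lattice covariance identities (3.29)–(3.32) themselves.  With
`…AdmissibleFloorLetters` ((flat), (adm)), `…SqrtFormPerturbationLetters` ((pert)), `…IMSErrorLetters` (`ε`) every letter of `admissible_floor` now has a
generic supplier in the tree.

WHAT IS PROVED ([folklore]; bond index `B`, colour index `κ`, plaquette∕average index `P`; `U : B → Matrix κ κ ℝ`, `R : P → Matrix κ κ ℝ` with `Uᵀ U = 1`):
* §1 **`dotProduct_mulVec_self_of_orthogonal`** (`UᵀU = 1` ⊢ `(U x) ⬝ᵥ (U x) = x ⬝ᵥ x`), `dotProduct_prod_eq_sum_blocks` (`X ⬝ᵥ X = Σ_b X_b ⬝ᵥ X_b` on `B × κ`),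
  **`iso_letter_of_blockwise_orthogonal`** — the bondwise gauge action `(uX)(b,·) = U_b · X(b,·)` ⊢ `uX ⬝ᵥ uX = X ⬝ᵥ X` (the (iso) letter, for EVERY `X`, hence for
  every localised piece `h_s·x`).
* §2 **`sumSq_eq_of_summandwise_covariance`** (`f_p(uX) = R_p · g_p(X)`, `R_pᵀR_p = 1` ⊢ `Σ_p f_p(uX) ⬝ᵥ f_p(uX) = Σ_p g_p(X) ⬝ᵥ g_p(X)`),
  **`cov_letter_of_summandwise_covariance`** — + `⟨X, K_F X⟩ = Σ_p g_p(X) ⬝ᵥ g_p(X)` (the matrix `K_F` of the full form at the background `V`) and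
  `F′ Y = Σ_p f_p(Y) ⬝ᵥ f_p(Y)` (the full form at the gauged background `V^u`) ⊢ `X ⬝ᵥ (K_F X) = F′(uX)` — VERBATIM the (cov) letter of `admissible_floor`.
* §3 toy: `κ = Fin 2`, one bond, the rotation by `π` (`U = −1`) — (iso) holds (`example`).

NOT HERE (honest): `Ad(u) ∈ SO(3)` for `u ∈ SU(2)` and the lattice identities (3.29)–(3.32) BY VALUE (print's objects; the NE9 chain's `B9Eq331LatticeCov` ∕
`B9Eq332AvgCovariance` are the complex-operator statements of the same covariance — other currency, not bridged here); WHICH gauge `u_s` ((π4)∕R-V);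
(A3) ∕ (A1c); NC-NE7b-α UNRULED.  BY-NAME EFFECT ON THE WALL: NONE.  NE7b NOT PRINTED ∕ NOT PROVED; spine PROVED 0∕9; rung (B)+1 on ONE finite T⁴ — NOT
infinite volume, NOT the mass gap, NOT Clay.
HONEST DEPENDENCY: continuum YM on T⁴ ⇐ BetaPertH ∧ nine spine estimates (0/9 proved); BetaPertH ⇐ (D1) ∧ (D4) ∧ CAP+tail; G-an2-4 gates asym, D1 and NE2/3/4.
-/

set_option autoImplicit false

open Matrix Finset

namespace Summit.QuantumFields.BalabanUV.T4Continuum.NE7b.GaugeCovarianceLetters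

variable {B κ P : Type*} [Fintype B] [Fintype κ] [DecidableEq κ] [Fintype P]

/-! ## §1 (iso): a bondwise orthogonal action preserves `⬝ᵥ` -/

section Iso

omit [Fintype B] [Fintype P] in
/-- **ORTHOGONAL ⟹ ISOMETRY OF `⬝ᵥ`**: `UᵀU = 1` ⊢ `(U x) ⬝ᵥ (U x) = x ⬝ᵥ x` (`Ad(u)` on `𝔤`). [folklore] -/
theorem dotProduct_mulVec_self_of_orthogonal (U : Matrix κ κ ℝ) (hU : Uᵀ * U = 1) (x : κ → ℝ) :
    (U *ᵥ x) ⬝ᵥ (U *ᵥ x) = x ⬝ᵥ x := by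
  rw [Matrix.dotProduct_mulVec, ← Matrix.mulVec_transpose, Matrix.mulVec_mulVec, hU, Matrix.one_mulVec]

omit [DecidableEq κ] [Fintype P] in
/-- `X ⬝ᵥ Y = Σ_b X(b,·) ⬝ᵥ Y(b,·)` on the product index `B × κ`. [folklore] -/
theorem dotProduct_prod_eq_sum_blocks (X Y : B × κ → ℝ) :
    X ⬝ᵥ Y = ∑ b, (fun a => X (b, a)) ⬝ᵥ (fun a => Y (b, a)) := by
  simp only [dotProduct, Fintype.sum_prod_type]

omit [Fintype P] in
/-- **THE (iso) LETTER FROM A BONDWISE ORTHOGONAL GAUGE ACTION**: `(uX)(b,·) = U_b · X(b,·)` with every `U_bᵀU_b = 1` ⊢ `uX ⬝ᵥ uX = X ⬝ᵥ X` for EVERY field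
`X` — hence for every localised piece `h_s·x` (the `hiso` letter of `…AdmissibleFloorIMS.admissible_floor`). [folklore] -/
theorem iso_letter_of_blockwise_orthogonal (U : B → Matrix κ κ ℝ) (hU : ∀ b, (U b)ᵀ * U b = 1)
    (u : (B × κ → ℝ) → (B × κ → ℝ)) (hu : ∀ X b a, u X (b, a) = (U b *ᵥ fun a' => X (b, a')) a) (X : B × κ → ℝ) :
    u X ⬝ᵥ u X = X ⬝ᵥ X := by
  rw [dotProduct_prod_eq_sum_blocks, dotProduct_prod_eq_sum_blocks X X]
  refine Finset.sum_congr rfl fun b _ => ?_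
  have e : (fun a => u X (b, a)) = U b *ᵥ fun a' => X (b, a') := funext fun a => hu X b a
  rw [e, dotProduct_mulVec_self_of_orthogonal (U b) (hU b)]

end Iso

/-! ## §2 (cov): summand-wise covariance ⟹ the full form is gauge invariant -/

section Cov

variable {m : Type*}

omit [Fintype B] in
/-- **SUMMAND-WISE COVARIANCE ⟹ EQUAL SUMS OF SQUARES**: `f_p(uX) = R_p · g_p(X)` with `R_pᵀR_p = 1` ⊢ `Σ_p f_p(uX) ⬝ᵥ f_p(uX) = Σ_p g_p(X) ⬝ᵥ g_p(X)`
(«`|·|` is `Ad`-invariant»). [folklore] -/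
theorem sumSq_eq_of_summandwise_covariance (f g : P → (m → ℝ) → (κ → ℝ)) (R : P → Matrix κ κ ℝ) (hR : ∀ p, (R p)ᵀ * R p = 1)
    (u : (m → ℝ) → (m → ℝ)) (X : m → ℝ) (hcomm : ∀ p, f p (u X) = R p *ᵥ g p X) :
    ∑ p, f p (u X) ⬝ᵥ f p (u X) = ∑ p, g p X ⬝ᵥ g p X :=
  Finset.sum_congr rfl fun p _ => by rw [hcomm p, dotProduct_mulVec_self_of_orthogonal (R p) (hR p)]

omit [Fintype B] in
/-- **THE (cov) LETTER FROM SUMMAND-WISE COVARIANCE**: `K_F` the matrix of the full form at the background `V` (`⟨X, K_F X⟩ = Σ_p g_p(X) ⬝ᵥ g_p(X)`), `F′` the full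
form at the gauged background `V^u` (`F′ Y = Σ_p f_p(Y) ⬝ᵥ f_p(Y)`), covariance `f_p(uX) = R_p · g_p(X)` with orthogonal `R_p` ⊢ `X ⬝ᵥ (K_F X) = F′(uX)` — VERBATIM
the `hcov` letter of `…AdmissibleFloorIMS.admissible_floor` (there at `X := h_s·x`). [folklore] -/
theorem cov_letter_of_summandwise_covariance [Fintype m] (KF : Matrix m m ℝ) (F' : (m → ℝ) → ℝ)
    (f g : P → (m → ℝ) → (κ → ℝ)) (R : P → Matrix κ κ ℝ) (hR : ∀ p, (R p)ᵀ * R p = 1) (u : (m → ℝ) → (m → ℝ))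
    (hKF : ∀ X, X ⬝ᵥ (KF *ᵥ X) = ∑ p, g p X ⬝ᵥ g p X) (hF' : ∀ Y, F' Y = ∑ p, f p Y ⬝ᵥ f p Y)
    (X : m → ℝ) (hcomm : ∀ p, f p (u X) = R p *ᵥ g p X) :
    X ⬝ᵥ (KF *ᵥ X) = F' (u X) := by
  rw [hKF, hF', sumSq_eq_of_summandwise_covariance f g R hR u X hcomm]

end Cov

/-! ## §3 Toy: one bond, `κ = Fin 2`, the rotation by `π` (`U = −1`) -/

section Toy

/- `U = −1` is orthogonal (`(−1)ᵀ(−1) = 1`); the bondwise action on `Unit × Fin 2` preserves `⬝ᵥ`. -/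
example (X : Unit × Fin 2 → ℝ) :
    (fun bc : Unit × Fin 2 => ((-1 : Matrix (Fin 2) (Fin 2) ℝ) *ᵥ fun a' => X (bc.1, a')) bc.2) ⬝ᵥ
      (fun bc : Unit × Fin 2 => ((-1 : Matrix (Fin 2) (Fin 2) ℝ) *ᵥ fun a' => X (bc.1, a')) bc.2) = X ⬝ᵥ X :=
  iso_letter_of_blockwise_orthogonal (fun _ => (-1 : Matrix (Fin 2) (Fin 2) ℝ)) (fun _ => by simp)
    (fun X bc => ((-1 : Matrix (Fin 2) (Fin 2) ℝ) *ᵥ fun a' => X (bc.1, a')) bc.2) (fun _ _ _ => rfl) X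

end Toy

end Summit.QuantumFields.BalabanUV.T4Continuum.NE7b.GaugeCovarianceLetters
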